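/-
Copyright: pub-rosobs cell (Resolution Observatory), carver gen 59.  Companion file; statements OURS — the
one-variable antiderivative in characteristic `p` that carries step (2) ("heavy slots can be fixed") of engine 1's
THEOREM U (THEOREM-LT-eng1-g38 §14; CARVER-NOTES-eng1-g38 T69 (U1)), in the cell's POLYNOMIAL weighted-centre model
`W(f)`.  Instrument — NOT a resolution theorem, NOT a statement about the invariant of [AbramovichTemkinWlodarczyk2024],
NOT summit progress.  AI-written Lean; AI review is weaker than expert review.
-/
import Mathlib.RingTheory.MvPolynomial.WeightedHomogeneous
import Mathlib.Algebra.MvPolynomial.PDeriv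
import Mathlib.Algebra.MvPolynomial.Variables
import Mathlib.Algebra.CharP.Defs
import HarnessLib

/-!
# Integration along one variable in characteristic `p`

Setting: `K` a field, `R = MvPolynomial σ K`, a slot `i : σ` (engine 1: the bottom slot `W_n`, on which the twisted-flow
derivation `D′` acts as `∂_{W_n}`).  For `h ∈ R` put

`integrate i h := Σ_{m ∈ supp h} (coeff_m h / (m_i + 1)) · X^{m + e_i}`

(every monomial `c·X^m` becomes `c/(m_i+1)·X^m·X_i`).  Then:

* `pderiv_integrate` : if `(m_i + 1 : K) ≠ 0` for every monomial `X^m` of `h`, then `∂_i (integrate i h) = h`;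
  in characteristic `p` this holds as soon as `p ∤ m_i + 1` on the support (`pderiv_integrate_of_not_dvd`), in particular
  when every exponent of `X_i` in `h` is `< p − 1` (`pderiv_integrate_of_lt`, `pderiv_integrate_of_degreeOf_lt`) — the
  engine's hypothesis "the `W`-degree of `h = E_p V` is `≤ (p−1)/2 < p − 1`, so divide the coefficient of `W_n^j` by
  `j + 1 ≤ (p+1)/2`, invertible";
* bookkeeping: `coeff_integrate`, `coeff_integrate_of_apply_eq_zero` (no monomial of `integrate i h` is free of `X_i`),
  `support_integrate_subset`, `degreeOf_integrate_le` / `degreeOf_integrate_le_of_ne` (exponents at `i` grow by at most one,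
  the others not at all), `vars_integrate_subset` (`vars ⊆ insert i (vars h)`: the antiderivative lives in the same
  subring `R_{<V}` as `h`, plus `W_n`);
* weights: `isWeightedHomogeneous_integrate` — if `h` is `w`-weighted-homogeneous of weight `ω` then `integrate i h` is
  weighted-homogeneous of weight `ω + w i` (engine: `h = D′V` of weight `w_V − 1/(p+1)`, `w(W_n) = 1/(p+1)`, so
  `s := ∫ h dW_n` has weight `w_V` and `V ↦ V − s` is a GRADED triangular change);
* the use in THEOREM U (2), as typed here: `pderiv_sub_integrate` — with `s := integrate i h` and `∂_i V = 0`... no slot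
  structure is assumed: for ANY `V` with `pderiv i V = v`, `pderiv i (V - integrate i h) = v - h`; the engine takes `V` a heavy
  slot (so `v = 0` for the restriction `D′ = ∂_{W_n}`... there `D′ V = h` is the DEFINITION of `h`, and the conclusion
  `D′(V − s) = h − ∂_{W_n} s = 0` is `sub_self`).

What is NOT here: the derivation `D′ = E_p|_R` and its truncated exponential `Ψ_u` (engine THEOREM B⁗ (iii); the cell's
`WeightedCentreTruncatedExponential.sigmaExp` is the natural home), the weight inequality
`(p+1)(w_V − 1/(p+1)) ≤ (p−1)/2` (engine, from `w_V ≤ 1/2`), and the induction over the heavy classes.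

References: the twisted-flow / boundary normal form is engine 1's (THEOREM-LT-eng1-g38 §12, §14), in the cell's model of
[cite: AbramovichTemkinWlodarczyk2024, §5.1 (p. 1575), Thm. 5.3.1 (2)–(3) (p. 1578)] (weighted centres; CONTEXT ONLY);
formal antiderivatives / derivations of polynomial rings in characteristic `p`: [cite: Matsumura1987, §25–§27 (pp. 190–209)]
(classical background; the packaging is ours).
-/

namespace Literature.AlgebraicGeometry.Resolution.WeightedBlowup.CharPIntegration

open MvPolynomial

noncomputable section

variable {K : Type*} [Field K] {σ : Type*}

/-- The formal antiderivative of `h` along `X_i` (ours): every monomial `c · X^m` of `h` becomes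
`c / (m_i + 1) · X^{m + e_i}`.  [cite: Matsumura1987, §25 (pp. 190–192)] -/
def integrate (i : σ) (h : MvPolynomial σ K) : MvPolynomial σ K :=
  ∑ m ∈ h.support, monomial (m + Finsupp.single i 1) (coeff m h / ((m i : K) + 1))

/-- `∂_i (c · X^{m + e_i}) = c (m_i + 1) · X^m` (derived here). [cite: Matsumura1987, §25 (pp. 190–192)] -/
theorem pderiv_monomial_add_single (i : σ) (m : σ →₀ ℕ) (c : K) :
    pderiv i (monomial (m + Finsupp.single i 1) c) = monomial m (c * ((m i : K) + 1)) := by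
  rw [pderiv_monomial, add_tsub_cancel_right, Finsupp.add_apply, Finsupp.single_eq_same, Nat.cast_add, Nat.cast_one]

/-- `integrate i 0 = 0` (derived here). [cite: Matsumura1987, §25 (pp. 190–192)] -/
@[simp] theorem integrate_zero (i : σ) : integrate i (0 : MvPolynomial σ K) = 0 := by
  rw [integrate, MvPolynomial.support_zero, Finset.sum_empty]

/-- **U1, main identity** (derived here): if `(m_i + 1 : K) ≠ 0` for every monomial `X^m` of `h`, then
`∂_i (integrate i h) = h`. [cite: Matsumura1987, §25 (pp. 190–192)] -/
theorem pderiv_integrate (i : σ) {h : MvPolynomial σ K} (hh : ∀ m ∈ h.support, ((m i : K) + 1) ≠ 0) :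
    pderiv i (integrate i h) = h := by
  rw [integrate, map_sum]
  conv_rhs => rw [h.as_sum]
  refine Finset.sum_congr rfl fun m hm => ?_
  rw [pderiv_monomial_add_single, div_mul_cancel₀ _ (hh m hm)]

/-- In characteristic `p`: `(n + 1 : K) ≠ 0` as soon as `p ∤ n + 1` (derived here). [cite: Matsumura1987, §25 (pp. 190–192)] -/
theorem natCast_add_one_ne_zero (p : ℕ) [CharP K p] {n : ℕ} (hn : ¬ p ∣ n + 1) : ((n : K) + 1) ≠ 0 := by
  rw [← Nat.cast_succ, Ne, CharP.cast_eq_zero_iff K p]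
  exact hn

/-- **U1 in characteristic `p`** (derived here): `p ∤ m_i + 1` on the support of `h` ⇒ `∂_i (integrate i h) = h`.
[cite: Matsumura1987, §25 (pp. 190–192)] -/
theorem pderiv_integrate_of_not_dvd (p : ℕ) [CharP K p] (i : σ) {h : MvPolynomial σ K}
    (hh : ∀ m ∈ h.support, ¬ p ∣ m i + 1) : pderiv i (integrate i h) = h :=
  pderiv_integrate i fun m hm => natCast_add_one_ne_zero p (hh m hm)

/-- **U1, the engine's form** (derived here): if every exponent of `X_i` in `h` is `< p − 1` (i.e. `m_i + 1 < p`), then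
`∂_i (integrate i h) = h` in characteristic `p`. [cite: Matsumura1987, §25 (pp. 190–192)] -/
theorem pderiv_integrate_of_lt (p : ℕ) [CharP K p] (i : σ) {h : MvPolynomial σ K}
    (hh : ∀ m ∈ h.support, m i + 1 < p) : pderiv i (integrate i h) = h :=
  pderiv_integrate_of_not_dvd p i fun m hm hdvd =>
    absurd (Nat.le_of_dvd (Nat.succ_pos _) hdvd) (not_le.mpr (hh m hm))

/-- The same with the hypothesis on `degreeOf` (derived here): `degreeOf i h + 1 < p` ⇒ `∂_i (integrate i h) = h`.
[cite: Matsumura1987, §25 (pp. 190–192)] -/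
theorem pderiv_integrate_of_degreeOf_lt (p : ℕ) [CharP K p] (i : σ) {h : MvPolynomial σ K}
    (hh : degreeOf i h + 1 < p) : pderiv i (integrate i h) = h :=
  pderiv_integrate_of_lt p i fun m hm =>
    lt_of_le_of_lt (Nat.succ_le_succ (degreeOf_le_iff.mp le_rfl m hm)) hh

/-- Coefficients of the antiderivative (derived here): `coeff_{m + e_i} (integrate i h) = coeff_m h / (m_i + 1)`.
[cite: Matsumura1987, §25 (pp. 190–192)] -/
theorem coeff_integrate (i : σ) (h : MvPolynomial σ K) (m : σ →₀ ℕ) :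
    coeff (m + Finsupp.single i 1) (integrate i h) = coeff m h / ((m i : K) + 1) := by
  classical
  rw [integrate, coeff_sum]
  simp_rw [coeff_monomial]
  rw [Finset.sum_eq_single m]
  · rw [if_pos rfl]
  · intro m' _ hne
    rw [if_neg]
    exact fun h => hne (add_right_cancel h)
  · intro hm
    rw [if_pos rfl, MvPolynomial.notMem_support_iff.mp hm, zero_div]

/-- No monomial of `integrate i h` is free of `X_i` (derived here). [cite: Matsumura1987, §25 (pp. 190–192)] -/
theorem coeff_integrate_of_apply_eq_zero (i : σ) (h : MvPolynomial σ K) {d : σ →₀ ℕ} (hd : d i = 0) :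
    coeff d (integrate i h) = 0 := by
  classical
  rw [integrate, coeff_sum]
  refine Finset.sum_eq_zero fun m _ => ?_
  rw [coeff_monomial, if_neg]
  intro hmd
  have h1 := DFunLike.congr_fun hmd i
  rw [Finsupp.add_apply, Finsupp.single_eq_same, hd] at h1
  exact Nat.succ_ne_zero _ h1

/-- Support of the antiderivative (derived here): every monomial of `integrate i h` is `X^{m + e_i}` for a monomial `X^m`
of `h`. [cite: Matsumura1987, §25 (pp. 190–192)] -/
theorem support_integrate_subset [DecidableEq σ] (i : σ) (h : MvPolynomial σ K) :
    (integrate i h).support ⊆ h.support.image fun m => m + Finsupp.single i 1 := by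
  classical
  intro d hd
  rw [integrate] at hd
  obtain ⟨m, hm, hdm⟩ := Finset.mem_biUnion.mp (support_sum hd)
  rw [Finset.mem_image]
  refine ⟨m, hm, ?_⟩
  rw [support_monomial] at hdm
  split_ifs at hdm with h0
  · exact absurd hdm (Finset.notMem_empty _)
  · exact (Finset.mem_singleton.mp hdm).symm

/-- Exponents at `i` grow by at most one (derived here). [cite: Matsumura1987, §25 (pp. 190–192)] -/
theorem degreeOf_integrate_le (i : σ) (h : MvPolynomial σ K) :
    degreeOf i (integrate i h) ≤ degreeOf i h + 1 := by
  classical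
  rw [degreeOf_le_iff]
  intro d hd
  obtain ⟨m, hm, rfl⟩ := Finset.mem_image.mp (support_integrate_subset i h hd)
  rw [Finsupp.add_apply, Finsupp.single_eq_same]
  exact Nat.succ_le_succ (degreeOf_le_iff.mp le_rfl m hm)

/-- Exponents at the other variables do not grow (derived here). [cite: Matsumura1987, §25 (pp. 190–192)] -/
theorem degreeOf_integrate_le_of_ne {i j : σ} (hji : j ≠ i) (h : MvPolynomial σ K) :
    degreeOf j (integrate i h) ≤ degreeOf j h := by
  classical
  rw [degreeOf_le_iff]
  intro d hd
  obtain ⟨m, hm, rfl⟩ := Finset.mem_image.mp (support_integrate_subset i h hd)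
  rw [Finsupp.add_apply, Finsupp.single_eq_of_ne hji, add_zero]
  exact degreeOf_le_iff.mp le_rfl m hm

/-- Variables of the antiderivative (derived here): `vars (integrate i h) ⊆ insert i (vars h)` — the antiderivative lives in
the subring generated by the variables of `h` and `X_i`. [cite: Matsumura1987, §25 (pp. 190–192)] -/
theorem vars_integrate_subset [DecidableEq σ] (i : σ) (h : MvPolynomial σ K) :
    (integrate i h).vars ⊆ insert i h.vars := by
  intro j hj
  rw [mem_vars_iff_mem_support] at hj
  obtain ⟨d, hd, hjd⟩ := hj
  obtain ⟨m, hm, rfl⟩ := Finset.mem_image.mp (support_integrate_subset i h hd)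
  rw [Finset.mem_insert]
  by_cases hji : j = i
  · exact Or.inl hji
  · right
    rw [mem_vars_iff_mem_support]
    refine ⟨m, hm, ?_⟩
    rw [Finsupp.mem_support_iff] at hjd ⊢
    rwa [Finsupp.add_apply, Finsupp.single_eq_of_ne hji, add_zero] at hjd

section Weights

variable {M : Type*} [AddCommMonoid M]

/-- **U1, weights** (derived here): if `h` is `w`-weighted-homogeneous of weight `ω`, then `integrate i h` is
weighted-homogeneous of weight `ω + w i`. [cite: AbramovichTemkinWlodarczyk2024, Thm. 5.3.1 (2)–(3) (p. 1578)] -/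
theorem isWeightedHomogeneous_integrate (w : σ → M) (i : σ) {h : MvPolynomial σ K} {ω : M}
    (hh : IsWeightedHomogeneous w h ω) : IsWeightedHomogeneous w (integrate i h) (ω + w i) := by
  rw [integrate]
  refine IsWeightedHomogeneous.sum _ _ _ fun m hm => isWeightedHomogeneous_monomial _ _ _ ?_
  rw [map_add, Finsupp.weight_apply w (Finsupp.single i 1), Finsupp.sum_single_index (zero_smul ℕ (w i)), one_smul,
    hh (MvPolynomial.mem_support_iff.mp hm)]

/-- The same in submodule form (derived here). [cite: AbramovichTemkinWlodarczyk2024, Thm. 5.3.1 (2)–(3) (p. 1578)] -/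
theorem integrate_mem_weightedHomogeneousSubmodule (w : σ → M) (i : σ) {h : MvPolynomial σ K} {ω : M}
    (hh : h ∈ weightedHomogeneousSubmodule K w ω) :
    integrate i h ∈ weightedHomogeneousSubmodule K w (ω + w i) :=
  (mem_weightedHomogeneousSubmodule K w _ _).mpr
    (isWeightedHomogeneous_integrate w i ((mem_weightedHomogeneousSubmodule K w _ _).mp hh))

end Weights

/-- **THEOREM U, step (2), as used** (derived here): for ANY `V` and `h` with the divisibility hypothesis,
`∂_i (V − integrate i h) = ∂_i V − h`; the engine applies it with `D′|_{R_{<V}} = ∂_{W_n}`, `h := D′V`, so that the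
corrected slot `V* := V − ∫ h dW_n` satisfies `D′V* = 0`. [cite: Matsumura1987, §25 (pp. 190–192)] -/
theorem pderiv_sub_integrate (p : ℕ) [CharP K p] (i : σ) (V : MvPolynomial σ K) {h : MvPolynomial σ K}
    (hh : ∀ m ∈ h.support, m i + 1 < p) : pderiv i (V - integrate i h) = pderiv i V - h := by
  rw [map_sub, pderiv_integrate_of_lt p i hh]

end

end Literature.AlgebraicGeometry.Resolution.WeightedBlowup.CharPIntegration
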